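import Literature.MathematicalPhysics.QuantumFieldTheory.Balaban1983to89.B2Prop22Proof
import Literature.MathematicalPhysics.QuantumFieldTheory.Balaban1983to89.B1Ineq225RegularTorus
import Literature.MathematicalPhysics.QuantumFieldTheory.Balaban1983to89.HiggsFluctMeasurePos

/-!
# `Balaban1983to89.B2Ineq258HiggsTorus` — [Balaban1982Higgs2] **(2.58)** (Prop. 2.2, pp. 570–571) FOR THE
# (Higgs)₂,₃ CARRIER'S OWN OPERATORS `G^ε_K(T_ε, A)Q_K^*(A)` AND `D^ε_A G^ε_K(T_ε, A)Q_K^*(A)` ON `Ω = T_ε`, AT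
# EVERY (I.2.23)-REGULAR VECTOR FIELD `A` («Let us notice that the conclusions of Proposition 2.2 hold for
# `G_kQ_k^*`», II p. 571): p35 g11's (I.2.25)-at-a-regular-field theorems for the carrier
# (`B1Ineq225RegularTorus`) evaluated at the source `Q_K^*(A)(vδ_y)` of p17 g2's dictionary (`B2Prop22Proof` §2)

statement-level skeleton of published theorems with citation tags; proofs where landed; nothing here is a claim
about the Yang–Mills mass gap

## What is printed, and what this file proves

[Balaban1982Higgs2] Prop. 2.2 (p. 570): «Let `Ω` and `A` satisfy the assumptions of Proposition I.2.1, then for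
`e(L^kε)` sufficiently small there exist positive constants `δ₀, c₀, R₀` independent of `A, k, Ω` and depending on
`d, a, M`, such that `|(D^η_A G_k(Ω, A)Q_k^*(A))(b, y)| ≤ c₀ exp(−δ₀ dist(b, y))` (2.58) for `b ⊂ Ω`,
`dist(b, Ωᶜ) ≥ R₀`, `y ∈ Ω^{(k)}`. The identical inequality holds for `G_k(Ω, A)Q_k^*(A)` …» — «a simple corollary of
Proposition I.2.1»; and (p. 571) «Let us notice that the conclusions of Proposition 2.2 hold for `G_kQ_k^*`», i.e.
for `Ω =` the whole torus, where ([Balaban1982Higgs1] p. 611) «the condition `dist({x,x′}, Ωᶜ) ≥ R₀` is meaningless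
and is omitted».

The general-`Ω` statement at `A ≠ 0` is PROVED (typed decl of record `B2StepK.Prop22Printed`) on r01's region-pair
families in `B2Prop22RegularRegionPair` / `B2Prop22RegularTorusPair`.  THIS file proves the `Ω = T_ε` case FOR THE
CARRIER ITSELF — the tree's concrete (Higgs)₂,₃ operators of `HiggsCovariance` (`propagatorK C univ A m² a K` =
`G^ε_K(T_ε, A) = (L^Kε)² G_K` in the ε-lattice currency of I (2.20)/(2.22), `avgQkAdj C A K` = `Q_K^*(A)`,
`covDeriv C A` = `D^ε_A`) — at EVERY vector field `A` obeying the printed regularity (I.2.23) with constants `(c, β)`: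

* `ineq258_GQ_higgs_torus` — **(2.58) for `G^ε_K(T_ε,A)Q_K^*(A)`**: `‖(G^ε_K Q_K^*(A)(vδ_y))(x)‖ ≤
  c₀ (L^Kε)² exp(−δ₀(K₀)·dist(x, B^K(y))/L^K)·|v|` for all `x ∈ T_ε`, `y ∈ T^{(K)}_1`, `v ∈ ℝ^N`;
* `ineq258_DGQ_higgs_torus` — **(2.58) for `D^ε_A G^ε_K(T_ε,A)Q_K^*(A)`**: `‖(D^ε_A G^ε_K Q_K^*(A)(vδ_y))(b)‖ ≤
  c₀ (L^Kε) exp(−δ₀(K₀)·dist(b₋, B^K(y))/L^K)·|v|` for all bonds `b`, `y`, `v`;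
* (v1.1, §3) `ineq258_GQ_higgs_torus_coarse` / `ineq258_DGQ_higgs_torus_coarse` — the same two bounds with the
  PRINTED exponent «`exp(−δ₀ dist(b, y))`» read on the unit lattice `T^{(K)}_1` (coarse distance `|x_K − y|`, the
  reading in which `B2Lemma23HiggsLattice` consumes Prop. 2.2 on this carrier), constant `c₀e^{δ₀(K₀)}`, via the block
  geometry `|x_K − y| ≤ dist(x, B^K(y))/L^K + 1` (`tdist_blockIter_le_blockDist`, from r14's `tdist_blockIter_le_real`).

Both are two-line corollaries («simple corollary of Proposition I.2.1») of p35 g11's PROVED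
`B1Ineq225RegularTorus.norm_propagatorK_reg_decay` / `norm_covDeriv_propagatorK_reg_decay` (I (2.25) at a regular
field, for an arbitrary source `g` with `‖g‖_∞ ≤ M` vanishing within distance `D` of the evaluation point), fed with
the source `g := Q_K^*(A)(vδ_y)`, `M := |v|` (p17's `norm_avgQkAdj_single_le`: the transports are unitary) and
`D := dist(x, B^K(y))` (p17's `avgQkAdj_single_of_ne`: `supp Q_K^*(A)(vδ_y) ⊆ B^K(y)`).

## Honest differences from print (inherited from `B1Ineq225RegularTorus`, recorded not hidden)

* currency: ε-lattice operators (`G^ε_K = (L^Kε)² G_K` unscaled, I (2.20)), hence the explicit mesh powers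
  `(L^Kε)²` / `(L^Kε)` and the distance measured in `L^K`-lattice-steps `dist/L^K` (= the unit-lattice distance of
  print after rescaling);
* the decay distance of §2 is `dist(x, B^K(y))` (distance to the block of `y`, what the support argument gives
  verbatim), which is `≤ dist(x, y)` of print and `≥ L^K(|x_K − y| − 1)`: §3 converts to the printed exponent read on
  `T^{(K)}_1` at the price `c₀ ↦ c₀e^{δ₀}`;
* constants: `c₀` uniform; `δ₀ = δ₀(K₀)` and the threshold `e₁(K₀)` depend on the partition-of-unity cube size `K₀`
  of p35's random-walk expansion (any fixed `K₀ ≥ K₀min` gives print's «constants independent of `A, k, Ω`»); the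
  torus side conditions `K₀ ∣ M`, `3K₀ ≤ 2M` and the mesh cap `L^Kε ≤ ε₀` are p35's standing hypotheses;
* only `Ω = T_ε` here (the case II p. 571 singles out); general `Ω` is the business of the region-pair files.

## References

* [Balaban1982Higgs2] T. Bałaban, (Higgs)₂,₃ quantum fields in a finite volume II. An upper bound,
  Comm. Math. Phys. 86 (1982) 555–594 — Prop. 2.2, (2.58), pp. 570–571.
* [Balaban1982Higgs1] T. Bałaban, (Higgs)₂,₃ quantum fields in a finite volume I. A lower bound,
  Comm. Math. Phys. 85 (1982) 603–636 — Prop. 2.1, (2.23), (2.25), pp. 610–611.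
* [Balaban1983RegularityDecay] T. Bałaban, Regularity and decay of lattice Green's functions,
  Comm. Math. Phys. 89 (1983) 571–597 — the method behind Prop. I.2.1.
-/

namespace Literature.MathematicalPhysics.QuantumFieldTheory.Balaban1983to89.B2Ineq258HiggsTorus

open Literature.MathematicalPhysics.QuantumFieldTheory.Balaban1983to89.HiggsLattice (ChargeData covDeriv)
open Literature.MathematicalPhysics.QuantumFieldTheory.Balaban1983to89.HiggsAveraging (blockIter blockK mem_blockK)
open Literature.MathematicalPhysics.QuantumFieldTheory.Balaban1983to89.HiggsCovariance (propagatorK avgQkAdj)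
open Literature.MathematicalPhysics.QuantumFieldTheory.Balaban1983to89.B2Prop22Proof (norm_avgQkAdj_single_le
  avgQkAdj_single_of_ne)
open Literature.MathematicalPhysics.QuantumFieldTheory.Balaban1983to89.B1Ineq225RegularTorus
  (norm_propagatorK_reg_decay norm_covDeriv_propagatorK_reg_decay)
open Literature.MathematicalPhysics.QuantumFieldTheory.Balaban1983to89.HiggsFluctMeasurePos (blockIter_surjective)
open Literature.MathematicalPhysics.QuantumFieldTheory.Balaban1983to89.B1Ineq234Concrete (tdist_blockIter_le_real)

noncomputable section

variable {P : HiggsLattice.Params} {N : ℕ}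

/-! ## §1. The lattice-step distance from a fine point to a block `B^K(y)` -/

/-- **`dist(x, B^K(y))`** in lattice steps of `T_ε` (torus sup-distance, I (1.3)); `0` if the block is empty
(which does not happen for `K ≤ K_P`, `exists_blockDist_eq`).
[cite: Balaban1982Higgs2, (2.58) p.570 «dist(b, y)», dictionary] -/
def blockDist (K : ℕ) (x : HiggsLattice.Site P 0) (y : HiggsLattice.Site P K) : ℝ :=
  if h : (blockK K y).Nonempty then (blockK K y).inf' h (fun z => (HiggsLattice.Site.tdist x z : ℝ)) else 0

/-- `dist(x, B^K(y)) ≥ 0`. [cite: Balaban1982Higgs2, (2.58) p.570, dictionary] -/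
theorem blockDist_nonneg (K : ℕ) (x : HiggsLattice.Site P 0) (y : HiggsLattice.Site P K) :
    0 ≤ blockDist K x y := by
  unfold blockDist
  split_ifs with h
  · exact Finset.le_inf' _ _ fun z _ => Nat.cast_nonneg _
  · exact le_rfl

/-- `dist(x, B^K(y)) ≤ |x − z|` for every `z ∈ B^K(y)`. [cite: Balaban1982Higgs2, (2.58) p.570, dictionary] -/
theorem blockDist_le (K : ℕ) (x : HiggsLattice.Site P 0) {y : HiggsLattice.Site P K} {z : HiggsLattice.Site P 0}
    (hz : blockIter K z = y) : blockDist K x y ≤ (HiggsLattice.Site.tdist x z : ℝ) := by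
  have hm : z ∈ blockK K y := (mem_blockK K y z).2 hz
  unfold blockDist
  rw [dif_pos ⟨z, hm⟩]
  exact Finset.inf'_le _ hm

/-- the blocks are non-empty for `K ≤ K_P`, so `dist(x, B^K(y))` is attained: there is `z ∈ B^K(y)` with
`dist(x, B^K(y)) = |x − z|`. [cite: Balaban1982Higgs1, (2.2) p.608 «B^k(y)», dictionary] -/
theorem exists_blockDist_eq {K : ℕ} (hK : K ≤ P.K) (x : HiggsLattice.Site P 0) (y : HiggsLattice.Site P K) :
    ∃ z : HiggsLattice.Site P 0, blockIter K z = y ∧ blockDist K x y = (HiggsLattice.Site.tdist x z : ℝ) := by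
  obtain ⟨z₀, hz₀⟩ := blockIter_surjective hK y
  have hne : (blockK K y).Nonempty := ⟨z₀, (mem_blockK K y z₀).2 hz₀⟩
  obtain ⟨z, hz, heq⟩ := Finset.exists_mem_eq_inf' hne (fun z => (HiggsLattice.Site.tdist x z : ℝ))
  refine ⟨z, (mem_blockK K y z).1 hz, ?_⟩
  unfold blockDist
  rw [dif_pos hne, heq]

/-- **the source `Q_K^*(A)(vδ_y)` vanishes within `dist(x, B^K(y))` of `x`** (its support lies in `B^K(y)`: p17's
`avgQkAdj_single_of_ne`). [cite: Balaban1982Higgs2, Prop. 2.2 p.571 «simple corollary», dictionary] -/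
theorem blockDist_le_of_src_ne (C : ChargeData N) (A : HiggsLattice.VecField P 0) (K : ℕ)
    (x : HiggsLattice.Site P 0) (y : HiggsLattice.Site P K) (v : EuclideanSpace ℝ (Fin N))
    (z : HiggsLattice.Site P 0) (hz : avgQkAdj C A K (Pi.single y v) z ≠ 0) :
    blockDist K x y ≤ (HiggsLattice.Site.tdist x z : ℝ) := by
  refine blockDist_le K x ?_
  by_contra h
  exact hz (avgQkAdj_single_of_ne C A K y v h)

/-! ## §2. (2.58) for `G^ε_K(T_ε,A)Q_K^*(A)` and `D^ε_A G^ε_K(T_ε,A)Q_K^*(A)` at every regular `A` -/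

/-- **(2.58) FOR `G^ε_K(T_ε, A)Q_K^*(A)` AT EVERY (I.2.23)-REGULAR `A`** (ε-lattice currency, I (2.20)/(2.22)):
for `L ≥ 2`, `a, m² > 0`, `N`, charge data `(e, q)`, a mesh cap `ε₀` and a regularity pair `(c, β)`, `β > 0`,
there are `c₀ > 0`, `K₀min`, and for each cube size `K₀` a threshold `e₁(K₀) > 0` and a rate `δ₀(K₀) > 0`, such
that for `K₀ ≥ K₀min`, on EVERY torus `T_ε` of the carrier (dimension `d`, scale `L`, `K₀ ∣ M`, `3K₀ ≤ 2M`), at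
every level `1 ≤ K ≤ K_P` with `L^Kε ≤ ε₀`, for EVERY vector field `A` and coupling `0 < e_K ≤ e₁(K₀)` satisfying
the regularity (I.2.23) `L^Kε·|e|/e_K·|A(⟨x+e_μ, ν⟩) − A(⟨x, ν⟩)| ≤ c·e_K^{β−1}/L^K`, and for every `x ∈ T_ε`,
`y ∈ T^{(K)}_1`, `v ∈ ℝ^N`:
`‖(G^ε_K(T_ε, A)Q_K^*(A)(vδ_y))(x)‖ ≤ c₀ (L^Kε)² exp(−δ₀(K₀)·dist(x, B^K(y))/L^K)·|v|`
— the `(x, y)` kernel block of `G_KQ_K^*` applied to `v`, with NO `R₀` restriction (`Ω = T_ε`, I p. 611).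
[cite: Balaban1982Higgs2, Prop. 2.2 (2.58) pp.570–571 «The identical inequality holds for G_k(Ω,A)Q_k^*(A)» and
p.571 «the conclusions of Proposition 2.2 hold for G_kQ_k^*»] -/
theorem ineq258_GQ_higgs_torus (d L : ℕ) (hL : 2 ≤ L) {a : ℝ} (ha : 0 < a) {msq : ℝ} (hmsq : 0 < msq) (N : ℕ)
    (C : ChargeData N) (ε₀ : ℝ) (creg β : ℝ) (hcreg : 0 ≤ creg) (hβ : 0 < β) :
    ∃ c₀ : ℝ, 0 < c₀ ∧ ∃ K₀min : ℕ, ∃ e₁ δA : ℕ → ℝ, (∀ K₀, 0 < e₁ K₀ ∧ 0 < δA K₀) ∧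
      ∀ K₀ : ℕ, K₀min ≤ K₀ →
      ∀ (P : HiggsLattice.Params), P.d = d → P.L = L → K₀ ∣ P.M → 3 * K₀ ≤ 2 * P.M →
      ∀ {K : ℕ}, 1 ≤ K → K ≤ P.K → P.mesh K ≤ ε₀ →
      ∀ (A : HiggsLattice.VecField P 0) {ec : ℝ}, 0 < ec → ec ≤ e₁ K₀ →
      (∀ (x : HiggsLattice.Site P 0) (μ ν : Fin P.d),
          P.mesh K * |C.e| / ec * |A ⟨x.shift μ, ν⟩ - A ⟨x, ν⟩| ≤ creg * ec ^ (β - 1) / (P.L : ℝ) ^ K) →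
        ∀ (x : HiggsLattice.Site P 0) (y : HiggsLattice.Site P K) (v : EuclideanSpace ℝ (Fin N)),
          ‖propagatorK C Finset.univ A msq a K (avgQkAdj C A K (Pi.single y v)) x‖
            ≤ c₀ * P.mesh K ^ 2 * Real.exp (-(δA K₀ * (blockDist K x y / (P.L : ℝ) ^ K))) * ‖v‖ := by
  obtain ⟨c₀, hc₀, K₀min, e₁, δA, hcδ, h⟩ := norm_propagatorK_reg_decay d L hL ha hmsq N C ε₀ creg β hcreg hβ
  exact ⟨c₀, hc₀, K₀min, e₁, δA, hcδ, fun K₀ hK₀ P hPd hPL hK₀M h3M K hK1 hK hε A ec hec hle hreg x y v =>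
    h K₀ hK₀ P hPd hPL hK₀M h3M hK1 hK hε A hec hle hreg (avgQkAdj C A K (Pi.single y v)) ‖v‖ (blockDist K x y)
      (fun z => norm_avgQkAdj_single_le C A K y v z) (blockDist_nonneg K x y) x
      (fun z hz => blockDist_le_of_src_ne C A K x y v z hz)⟩

/-- **(2.58) FOR `D^ε_A G^ε_K(T_ε, A)Q_K^*(A)` AT EVERY (I.2.23)-REGULAR `A`**: same constants shape as
`ineq258_GQ_higgs_torus`; for every bond `b ⊂ T_ε`, `y ∈ T^{(K)}_1`, `v ∈ ℝ^N`:
`‖(D^ε_A G^ε_K(T_ε, A)Q_K^*(A)(vδ_y))(b)‖ ≤ c₀ (L^Kε) exp(−δ₀(K₀)·dist(b₋, B^K(y))/L^K)·|v|`.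
[cite: Balaban1982Higgs2, Prop. 2.2 (2.58) pp.570–571 and p.571 «the conclusions of Proposition 2.2 hold for
G_kQ_k^*»] -/
theorem ineq258_DGQ_higgs_torus (d L : ℕ) (hL : 2 ≤ L) {a : ℝ} (ha : 0 < a) {msq : ℝ} (hmsq : 0 < msq) (N : ℕ)
    (C : ChargeData N) (ε₀ : ℝ) (creg β : ℝ) (hcreg : 0 ≤ creg) (hβ : 0 < β) :
    ∃ c₀ : ℝ, 0 < c₀ ∧ ∃ K₀min : ℕ, ∃ e₁ δA : ℕ → ℝ, (∀ K₀, 0 < e₁ K₀ ∧ 0 < δA K₀) ∧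
      ∀ K₀ : ℕ, K₀min ≤ K₀ →
      ∀ (P : HiggsLattice.Params), P.d = d → P.L = L → K₀ ∣ P.M → 3 * K₀ ≤ 2 * P.M →
      ∀ {K : ℕ}, 1 ≤ K → K ≤ P.K → P.mesh K ≤ ε₀ →
      ∀ (A : HiggsLattice.VecField P 0) {ec : ℝ}, 0 < ec → ec ≤ e₁ K₀ →
      (∀ (x : HiggsLattice.Site P 0) (μ ν : Fin P.d),
          P.mesh K * |C.e| / ec * |A ⟨x.shift μ, ν⟩ - A ⟨x, ν⟩| ≤ creg * ec ^ (β - 1) / (P.L : ℝ) ^ K) →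
        ∀ (b : HiggsLattice.PBond P 0) (y : HiggsLattice.Site P K) (v : EuclideanSpace ℝ (Fin N)),
          ‖covDeriv C A (propagatorK C Finset.univ A msq a K (avgQkAdj C A K (Pi.single y v))) b‖
            ≤ c₀ * P.mesh K * Real.exp (-(δA K₀ * (blockDist K b.src y / (P.L : ℝ) ^ K))) * ‖v‖ := by
  obtain ⟨c₀, hc₀, K₀min, e₁, δA, hcδ, h⟩ :=
    norm_covDeriv_propagatorK_reg_decay d L hL ha hmsq N C ε₀ creg β hcreg hβ
  exact ⟨c₀, hc₀, K₀min, e₁, δA, hcδ, fun K₀ hK₀ P hPd hPL hK₀M h3M K hK1 hK hε A ec hec hle hreg b y v =>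
    h K₀ hK₀ P hPd hPL hK₀M h3M hK1 hK hε A hec hle hreg (avgQkAdj C A K (Pi.single y v)) ‖v‖
      (blockDist K b.src y) (fun z => norm_avgQkAdj_single_le C A K y v z) (blockDist_nonneg K b.src y) b
      (fun z hz => blockDist_le_of_src_ne C A K b.src y v z hz)⟩

/-! ## §3. The printed exponent «`dist(b, y)`» read on the unit lattice `T^{(K)}_1`: the coarse distance `|x_K − y|`
(v1.1 — the reading in which `B2Lemma23HiggsLattice` consumes Prop. 2.2's exponent on this carrier) -/

/-- **`|x_K − y|_{T^{(K)}} ≤ dist(x, B^K(y))/L^K + 1`** (`K ≤ K_P`): r14's block geometry `tdist_blockIter_le_real`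
(`L^K|x_K − z_K| ≤ |x − z| + L^K − 1`) at a point `z ∈ B^K(y)` attaining `dist(x, B^K(y))`.
[cite: Balaban1982Higgs1, (1.20) p.607 «B^k(y)», dictionary] -/
theorem tdist_blockIter_le_blockDist {K : ℕ} (hK : K ≤ P.K) (x : HiggsLattice.Site P 0) (y : HiggsLattice.Site P K) :
    (HiggsLattice.Site.tdist (blockIter K x) y : ℝ) ≤ blockDist K x y / (P.L : ℝ) ^ K + 1 := by
  obtain ⟨z, hz, heq⟩ := exists_blockDist_eq hK x y
  have h := tdist_blockIter_le_real hK x z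
  rw [hz] at h
  rw [heq]
  have hT : (0 : ℝ) < ((P.L : ℝ) ^ K)⁻¹ := inv_pos.2 (pow_pos (by exact_mod_cast P.hL) K)
  linarith

/-- **`e^{−δ·dist(x, B^K(y))/L^K} ≤ e^{δ}·e^{−δ|x_K − y|}`** for `δ ≥ 0`, `K ≤ K_P`: the block-distance exponent of §2
dominates print's `e^{−δ₀ dist(b, y)}` read on `T^{(K)}_1`, at the price `c₀ ↦ c₀e^{δ₀}`.
[cite: Balaban1982Higgs2, (2.58) p.570 «exp(−δ₀ dist(b, y))», dictionary] -/
theorem exp_blockDist_le {K : ℕ} (hK : K ≤ P.K) {δ : ℝ} (hδ : 0 ≤ δ) (x : HiggsLattice.Site P 0)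
    (y : HiggsLattice.Site P K) :
    Real.exp (-(δ * (blockDist K x y / (P.L : ℝ) ^ K)))
      ≤ Real.exp δ * Real.exp (-(δ * (HiggsLattice.Site.tdist (blockIter K x) y : ℝ))) := by
  rw [← Real.exp_add]
  refine Real.exp_le_exp.2 ?_
  have h := mul_le_mul_of_nonneg_left (tdist_blockIter_le_blockDist hK x y) hδ
  linarith

/-- **(2.58) FOR `G^ε_K(T_ε, A)Q_K^*(A)` AT EVERY (I.2.23)-REGULAR `A`, PRINTED EXPONENT** read on `T^{(K)}_1`:
same data and hypotheses as `ineq258_GQ_higgs_torus`; for every `x ∈ T_ε`, `y ∈ T^{(K)}_1`, `v ∈ ℝ^N`: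
`‖(G^ε_K(T_ε, A)Q_K^*(A)(vδ_y))(x)‖ ≤ c₀e^{δ₀(K₀)} (L^Kε)² exp(−δ₀(K₀)·|x_K − y|)·|v|` (`x_K` = the `K`-block label of
`x`; `|·|` the distance (I.1.3) of `T^{(K)}_1`). [cite: Balaban1982Higgs2, Prop. 2.2 (2.58) pp.570–571 and p.571 «the
conclusions of Proposition 2.2 hold for G_kQ_k^*»] -/
theorem ineq258_GQ_higgs_torus_coarse (d L : ℕ) (hL : 2 ≤ L) {a : ℝ} (ha : 0 < a) {msq : ℝ} (hmsq : 0 < msq)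
    (N : ℕ) (C : ChargeData N) (ε₀ : ℝ) (creg β : ℝ) (hcreg : 0 ≤ creg) (hβ : 0 < β) :
    ∃ c₀ : ℝ, 0 < c₀ ∧ ∃ K₀min : ℕ, ∃ e₁ δA : ℕ → ℝ, (∀ K₀, 0 < e₁ K₀ ∧ 0 < δA K₀) ∧
      ∀ K₀ : ℕ, K₀min ≤ K₀ →
      ∀ (P : HiggsLattice.Params), P.d = d → P.L = L → K₀ ∣ P.M → 3 * K₀ ≤ 2 * P.M →
      ∀ {K : ℕ}, 1 ≤ K → K ≤ P.K → P.mesh K ≤ ε₀ →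
      ∀ (A : HiggsLattice.VecField P 0) {ec : ℝ}, 0 < ec → ec ≤ e₁ K₀ →
      (∀ (x : HiggsLattice.Site P 0) (μ ν : Fin P.d),
          P.mesh K * |C.e| / ec * |A ⟨x.shift μ, ν⟩ - A ⟨x, ν⟩| ≤ creg * ec ^ (β - 1) / (P.L : ℝ) ^ K) →
        ∀ (x : HiggsLattice.Site P 0) (y : HiggsLattice.Site P K) (v : EuclideanSpace ℝ (Fin N)),
          ‖propagatorK C Finset.univ A msq a K (avgQkAdj C A K (Pi.single y v)) x‖
            ≤ c₀ * Real.exp (δA K₀) * P.mesh K ^ 2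
              * Real.exp (-(δA K₀ * (HiggsLattice.Site.tdist (blockIter K x) y : ℝ))) * ‖v‖ := by
  obtain ⟨c₀, hc₀, K₀min, e₁, δA, hcδ, h⟩ := ineq258_GQ_higgs_torus d L hL ha hmsq N C ε₀ creg β hcreg hβ
  refine ⟨c₀, hc₀, K₀min, e₁, δA, hcδ, fun K₀ hK₀ P hPd hPL hK₀M h3M K hK1 hK hε A ec hec hle hreg x y v => ?_⟩
  have h1 := h K₀ hK₀ P hPd hPL hK₀M h3M hK1 hK hε A hec hle hreg x y v
  have h2 := exp_blockDist_le hK (hcδ K₀).2.le x y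
  have hm : 0 ≤ c₀ * P.mesh K ^ 2 * ‖v‖ := by positivity
  calc ‖propagatorK C Finset.univ A msq a K (avgQkAdj C A K (Pi.single y v)) x‖
      ≤ c₀ * P.mesh K ^ 2 * Real.exp (-(δA K₀ * (blockDist K x y / (P.L : ℝ) ^ K))) * ‖v‖ := h1
    _ = (c₀ * P.mesh K ^ 2 * ‖v‖) * Real.exp (-(δA K₀ * (blockDist K x y / (P.L : ℝ) ^ K))) := by ring
    _ ≤ (c₀ * P.mesh K ^ 2 * ‖v‖) * (Real.exp (δA K₀)
          * Real.exp (-(δA K₀ * (HiggsLattice.Site.tdist (blockIter K x) y : ℝ)))) :=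
        mul_le_mul_of_nonneg_left h2 hm
    _ = c₀ * Real.exp (δA K₀) * P.mesh K ^ 2
          * Real.exp (-(δA K₀ * (HiggsLattice.Site.tdist (blockIter K x) y : ℝ))) * ‖v‖ := by ring

/-- **(2.58) FOR `D^ε_A G^ε_K(T_ε, A)Q_K^*(A)` AT EVERY (I.2.23)-REGULAR `A`, PRINTED EXPONENT** read on `T^{(K)}_1`:
for every bond `b`, `y`, `v`: `‖(D^ε_A G^ε_K Q_K^*(A)(vδ_y))(b)‖ ≤ c₀e^{δ₀(K₀)} (L^Kε) exp(−δ₀(K₀)·|(b₋)_K − y|)·|v|`.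
[cite: Balaban1982Higgs2, Prop. 2.2 (2.58) pp.570–571 and p.571 «the conclusions of Proposition 2.2 hold for
G_kQ_k^*»] -/
theorem ineq258_DGQ_higgs_torus_coarse (d L : ℕ) (hL : 2 ≤ L) {a : ℝ} (ha : 0 < a) {msq : ℝ} (hmsq : 0 < msq)
    (N : ℕ) (C : ChargeData N) (ε₀ : ℝ) (creg β : ℝ) (hcreg : 0 ≤ creg) (hβ : 0 < β) :
    ∃ c₀ : ℝ, 0 < c₀ ∧ ∃ K₀min : ℕ, ∃ e₁ δA : ℕ → ℝ, (∀ K₀, 0 < e₁ K₀ ∧ 0 < δA K₀) ∧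
      ∀ K₀ : ℕ, K₀min ≤ K₀ →
      ∀ (P : HiggsLattice.Params), P.d = d → P.L = L → K₀ ∣ P.M → 3 * K₀ ≤ 2 * P.M →
      ∀ {K : ℕ}, 1 ≤ K → K ≤ P.K → P.mesh K ≤ ε₀ →
      ∀ (A : HiggsLattice.VecField P 0) {ec : ℝ}, 0 < ec → ec ≤ e₁ K₀ →
      (∀ (x : HiggsLattice.Site P 0) (μ ν : Fin P.d),
          P.mesh K * |C.e| / ec * |A ⟨x.shift μ, ν⟩ - A ⟨x, ν⟩| ≤ creg * ec ^ (β - 1) / (P.L : ℝ) ^ K) →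
        ∀ (b : HiggsLattice.PBond P 0) (y : HiggsLattice.Site P K) (v : EuclideanSpace ℝ (Fin N)),
          ‖covDeriv C A (propagatorK C Finset.univ A msq a K (avgQkAdj C A K (Pi.single y v))) b‖
            ≤ c₀ * Real.exp (δA K₀) * P.mesh K
              * Real.exp (-(δA K₀ * (HiggsLattice.Site.tdist (blockIter K b.src) y : ℝ))) * ‖v‖ := by
  obtain ⟨c₀, hc₀, K₀min, e₁, δA, hcδ, h⟩ := ineq258_DGQ_higgs_torus d L hL ha hmsq N C ε₀ creg β hcreg hβ
  refine ⟨c₀, hc₀, K₀min, e₁, δA, hcδ, fun K₀ hK₀ P hPd hPL hK₀M h3M K hK1 hK hε A ec hec hle hreg b y v => ?_⟩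
  have h1 := h K₀ hK₀ P hPd hPL hK₀M h3M hK1 hK hε A hec hle hreg b y v
  have h2 := exp_blockDist_le hK (hcδ K₀).2.le b.src y
  have hm : 0 ≤ c₀ * P.mesh K * ‖v‖ := by
    have := P.mesh_pos K
    positivity
  calc ‖covDeriv C A (propagatorK C Finset.univ A msq a K (avgQkAdj C A K (Pi.single y v))) b‖
      ≤ c₀ * P.mesh K * Real.exp (-(δA K₀ * (blockDist K b.src y / (P.L : ℝ) ^ K))) * ‖v‖ := h1
    _ = (c₀ * P.mesh K * ‖v‖) * Real.exp (-(δA K₀ * (blockDist K b.src y / (P.L : ℝ) ^ K))) := by ring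
    _ ≤ (c₀ * P.mesh K * ‖v‖) * (Real.exp (δA K₀)
          * Real.exp (-(δA K₀ * (HiggsLattice.Site.tdist (blockIter K b.src) y : ℝ)))) :=
        mul_le_mul_of_nonneg_left h2 hm
    _ = c₀ * Real.exp (δA K₀) * P.mesh K
          * Real.exp (-(δA K₀ * (HiggsLattice.Site.tdist (blockIter K b.src) y : ℝ))) * ‖v‖ := by ring

end

end Literature.MathematicalPhysics.QuantumFieldTheory.Balaban1983to89.B2Ineq258HiggsTorus
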